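import Summits.AtomisticToContinuum.FouriersLaw.Theses.PhononMeanFreePath
import Summits.AtomisticToContinuum.FouriersLaw.Theorems.BoundaryKubo.Negative.LoadBearing
import Summits.AtomisticToContinuum.FouriersLaw.Theorems.BoundaryKubo.Negative.Reflection
import Summits.AtomisticToContinuum.FouriersLaw.Theorems.BondHeatUncertaintyLinearResponseFTURSteadyHeatRatesHelper2
import Summits.AtomisticToContinuum.FouriersLaw.Theorems.BondHeatUncertaintyLinearResponseFTURSteadyHeatRatesHelper3
import Literature.MathematicalPhysics.KineticTheory.HardTetherChain

/-!
# Energy balance of a weak steady state with one exponential moment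
(stub `stub_energyBalance` of line `gibbs-ttcf`, crux stmt-AtomisticToContinuum-11812 `PhononMeanFreePath.BoundaryKubo`)

For the pinned chain `P = pinnedChain ω₂ lam β γ` (all four `> 0`) with `N + 1` sites `0..N` and a WEAK steady
state `ν` at bath temperatures `T_L, T_R > 0` (`OscillatorChain.IsSteadyState`: `ν` a probability measure,
`∫ L f dν = 0` for `f ∈ C_c^∞`, bond currents integrable) with one exponential moment `e^{θH} ∈ L¹(ν)`,
`θ > 0`:  `totalCurrent ν = N · γ · (∫ p_N² dν - T_R)`.

Proof. One exponential moment gives all polynomial moments `(1 + H)^m ∈ L¹(ν)`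
(`pinnedChain_polynomialMoments`), so weak stationarity extends to smooth observables `f` with `f`, `Lf`,
`∂_{p_l} f = O((1 + H)^k)` (`pinnedChain_integral_generator_eq_zero_of_growth`: energy cut-off `f χ(H/R)` and
dominated convergence `R → ∞`, already in the tree). Tested on the left block energies `E_{≤i}`
(`HardTether.leftEnergy`; pointwise `j_i + L E_{≤i} = γ (T_L - p_0²)`,
`HardTether.bondCurrent_add_generator_leftEnergy`) this gives `ν(j_i) = γ (T_L - ν(p_0²))` for every genuine
bond `i < N` (`integral_bondCurrent_eq_left`); tested on `H` (`L H = γ(T_L - p_0²) + γ(T_R - p_N²)`) it gives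
`γ (T_L - ν(p_0²)) + γ (T_R - ν(p_N²)) = 0` (`bath_balance`), i.e. the right-end form
`ν(j_i) = γ (ν(p_N²) - T_R)`. The last index carries no bond (`bondCurrent_eq_zero_of_not_lt`), so the sum over
`Fin (N + 1)` is `N · γ (ν(p_N²) - T_R)` (`Fin.sum_univ_castSucc`); `N = 0` is the degenerate case `0 = 0`.
-/

noncomputable section

open scoped NNReal ENNReal Topology ContDiff
open MeasureTheory Filter Set

namespace Summit.AtomisticToContinuum.FouriersLaw.Theorems.BoundaryKubo.GibbsTtcf

open Literature.MathematicalPhysics.KineticTheory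
open Literature.MathematicalPhysics.KineticTheory.HeatConduction
open Literature.MathematicalPhysics.KineticTheory.HeatConduction.HardTether
  (leftEnergy blockWeight bondWeight bondCurrent_add_generator_leftEnergy partialP_leftEnergy)
open Summit.AtomisticToContinuum.FouriersLaw.Theorems.SubdiffusiveBondHeat
open Summit.AtomisticToContinuum.FouriersLaw.Theorems.LinearResponseFTUR
open Summit.AtomisticToContinuum.FouriersLaw.Theorems.BoundaryKubo.Negative.Reflection
  (bondCurrent_eq_zero_of_not_lt)
open Summit.AtomisticToContinuum.FouriersLaw.Theorems.BoundaryKubo.Negative.LoadBearing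
  (kuboIntegrand kuboValue LimitClause UniqueSteady SteadyFamily boundaryKubo_iff)

variable {N : ℕ}

/-! ### The left block energy: smoothness and energy bounds -/

/-- The block weights `[k ≤ i]` lie in `[0, 1]`. [folklore] -/
theorem blockWeight_nonneg_le_one (i k : Fin N) : 0 ≤ blockWeight i k ∧ blockWeight i k ≤ 1 := by
  unfold blockWeight
  split_ifs <;> norm_num

/-- The bond weights of the left block energy lie in `[0, 1]`. [folklore] -/
theorem bondWeight_nonneg_le_one (i k : Fin N) : 0 ≤ bondWeight i k ∧ bondWeight i k ≤ 1 := by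
  unfold bondWeight
  split_ifs <;> norm_num

/-- The left block energy `E_{≤i}` is as smooth as the potentials. [folklore] -/
theorem contDiff_leftEnergy (P : OscillatorChain) {n : WithTop ℕ∞} (hU : ContDiff ℝ n P.U)
    (hV : ContDiff ℝ n P.V) (N : ℕ) (i : Fin N) : ContDiff ℝ n (leftEnergy P N i) := by
  unfold leftEnergy
  have hq : ∀ k : Fin N, ContDiff ℝ n fun x : PhaseSpace N => x.1 k := fun k =>
    (contDiff_apply ℝ ℝ k).comp contDiff_fst
  have hp : ∀ k : Fin N, ContDiff ℝ n fun x : PhaseSpace N => x.2 k := fun k =>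
    (contDiff_apply ℝ ℝ k).comp contDiff_snd
  apply ContDiff.add
  · exact ContDiff.sum fun k _ =>
      contDiff_const.mul ((((hp k).pow 2).div_const 2).add (hU.comp (hq k)))
  · refine ContDiff.sum fun k _ => ContDiff.sum fun l _ => ?_
    by_cases h : l.val = k.val + 1
    · simp only [h, if_true]
      exact contDiff_const.mul (hV.comp ((hq l).sub (hq k)))
    · simp only [h, if_false]
      exact contDiff_const

/-- `0 ≤ E_{≤i}` for nonnegative potentials. [folklore] -/
theorem leftEnergy_nonneg (P : OscillatorChain) (hU0 : ∀ q, 0 ≤ P.U q) (hV0 : ∀ r, 0 ≤ P.V r)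
    (N : ℕ) (i : Fin N) (x : PhaseSpace N) : 0 ≤ leftEnergy P N i x := by
  unfold leftEnergy
  refine add_nonneg (Finset.sum_nonneg fun k _ => mul_nonneg (blockWeight_nonneg_le_one i k).1
    (add_nonneg (by positivity) (hU0 _)))
    (Finset.sum_nonneg fun k _ => Finset.sum_nonneg fun l _ => ?_)
  split_ifs
  · exact mul_nonneg (bondWeight_nonneg_le_one i k).1 (hV0 _)
  · exact le_rfl

/-- `E_{≤i} ≤ H` for nonnegative potentials (all weights are at most `1`). [folklore] -/
theorem leftEnergy_le_hamiltonian (P : OscillatorChain) (hU0 : ∀ q, 0 ≤ P.U q)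
    (hV0 : ∀ r, 0 ≤ P.V r) (N : ℕ) (i : Fin N) (x : PhaseSpace N) :
    leftEnergy P N i x ≤ P.hamiltonian N x := by
  unfold leftEnergy OscillatorChain.hamiltonian
  refine add_le_add (Finset.sum_le_sum fun k _ => ?_)
    (Finset.sum_le_sum fun k _ => Finset.sum_le_sum fun l _ => ?_)
  · have h0 : 0 ≤ x.2 k ^ 2 / 2 + P.U (x.1 k) := add_nonneg (by positivity) (hU0 _)
    calc blockWeight i k * (x.2 k ^ 2 / 2 + P.U (x.1 k)) ≤ 1 * (x.2 k ^ 2 / 2 + P.U (x.1 k)) :=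
          mul_le_mul_of_nonneg_right (blockWeight_nonneg_le_one i k).2 h0
      _ = _ := one_mul _
  · split_ifs
    · calc bondWeight i k * P.V (x.1 l - x.1 k) ≤ 1 * P.V (x.1 l - x.1 k) :=
            mul_le_mul_of_nonneg_right (bondWeight_nonneg_le_one i k).2 (hV0 _)
        _ = _ := one_mul _
    · exact le_rfl

/-! ### Weak stationarity tested on `E_{≤i}` and on `H` -/

/-- The squared end momentum is integrable under polynomial energy moments (`p_k² ≤ 2H`). [folklore] -/
theorem integrable_sq_momentum {ω₂ lam β γ : ℝ} (hω : 0 < ω₂) (hl : 0 ≤ lam) (hβ : 0 ≤ β)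
    (hγ : 0 ≤ γ) {M : ℕ} {ν : Measure (PhaseSpace M)}
    (hmom : ∀ m : ℕ, Integrable (fun x => (1 + (pinnedChain ω₂ lam β γ).hamiltonian M x) ^ m) ν)
    (k : Fin M) : Integrable (fun x : PhaseSpace M => x.2 k ^ 2) ν := by
  have hconf := pinnedChain_isConfining hω hl hβ hγ
  refine ((hmom 1).const_mul 2).mono'
    (by fun_prop : Continuous fun x : PhaseSpace M => x.2 k ^ 2).aestronglyMeasurable
    (Eventually.of_forall fun x => ?_)
  rw [Real.norm_eq_abs, abs_of_nonneg (sq_nonneg _), pow_one]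
  have h1 := sq_momentum_le hconf.U_nonneg hconf.V_nonneg x k
  have h2 := hconf.hamiltonian_nonneg M x
  linarith

/-- **Left-end energy balance of one bond.** For the pinned chain (`ω₂ > 0`, `lam, β, γ ≥ 0`, `N + 1` sites,
`T_L, T_R ≥ 0`), a weak steady state `ν` with all polynomial energy moments and a genuine bond `i` (`i + 1 ≤ N`):
`ν(j_i) = γ (T_L - ν(p_0²))` — weak stationarity (extended to polynomially bounded observables) tested on the
left block energy `E_{≤i}`, whose generator is `γ(T_L - p_0²) - j_i` pointwise.
[Bonetto–Lebowitz–Rey-Bellet 2000, §5.2 eqs. (25)–(27)] [folklore] -/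
theorem integral_bondCurrent_eq_left {ω₂ lam β γ : ℝ} (hω : 0 < ω₂) (hl : 0 ≤ lam) (hβ : 0 ≤ β)
    (hγ : 0 ≤ γ) {T_L T_R : ℝ} (hTL : 0 ≤ T_L) (hTR : 0 ≤ T_R) {ν : Measure (PhaseSpace (N + 1))}
    (hν : (pinnedChain ω₂ lam β γ).IsSteadyState (N + 1) T_L T_R ν)
    (hmom : ∀ m : ℕ, Integrable (fun x => (1 + (pinnedChain ω₂ lam β γ).hamiltonian (N + 1) x) ^ m) ν)
    {i : Fin (N + 1)} (hi : i.val + 1 < N + 1) :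
    ∫ x, (pinnedChain ω₂ lam β γ).bondCurrent (N + 1) i x ∂ν = γ * (T_L - ∫ x, x.2 0 ^ 2 ∂ν) := by
  haveI := hν.1
  have hconf : (pinnedChain ω₂ lam β γ).IsConfining := pinnedChain_isConfining hω hl hβ hγ
  have hU0 := hconf.U_nonneg
  have hV0 := hconf.V_nonneg
  have hH0 : ∀ x, 0 ≤ (pinnedChain ω₂ lam β γ).hamiltonian (N + 1) x := hconf.hamiltonian_nonneg (N + 1)
  have hPγ : (pinnedChain ω₂ lam β γ).γ = γ := rfl
  have hN : 0 < N + 1 := Nat.succ_pos N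
  have h0 : (⟨0, hN⟩ : Fin (N + 1)) = 0 := rfl
  -- pointwise form of `L E_{≤i}`
  have hLf : ∀ x, (pinnedChain ω₂ lam β γ).generator (N + 1) T_L T_R
      (leftEnergy (pinnedChain ω₂ lam β γ) (N + 1) i) x =
      γ * (T_L - x.2 0 ^ 2) - (pinnedChain ω₂ lam β γ).bondCurrent (N + 1) i x := by
    intro x
    have e := bondCurrent_add_generator_leftEnergy (pinnedChain ω₂ lam β γ) hconf.differentiable_U
      hconf.differentiable_V hi T_L T_R x
    rw [sum_ite_val_eq hN (fun k => T_L - x.2 k ^ 2), hPγ, h0] at e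
    linarith
  -- the growth bounds
  have hp1 : ∀ (x : PhaseSpace (N + 1)) (k : Fin (N + 1)),
      |x.2 k| ≤ 1 + (pinnedChain ω₂ lam β γ).hamiltonian (N + 1) x :=
    fun x k => abs_momentum_le_one_add hU0 hV0 x k
  have hp2 : ∀ (x : PhaseSpace (N + 1)) (k : Fin (N + 1)),
      x.2 k ^ 2 ≤ 2 * (pinnedChain ω₂ lam β γ).hamiltonian (N + 1) x :=
    fun x k => sq_momentum_le hU0 hV0 x k
  set C : ℝ := 1 + γ * (T_L + 2) + ((N + 1 : ℕ) : ℝ) * ((3 + β) / 2) with hC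
  have hC1 : 1 ≤ C := by
    have : 0 ≤ γ * (T_L + 2) + ((N + 1 : ℕ) : ℝ) * ((3 + β) / 2) := by positivity
    rw [hC]; linarith
  have hfb : ∀ x, |leftEnergy (pinnedChain ω₂ lam β γ) (N + 1) i x| ≤
      C * (1 + (pinnedChain ω₂ lam β γ).hamiltonian (N + 1) x) ^ 2 := by
    intro x
    have h1 := leftEnergy_nonneg (pinnedChain ω₂ lam β γ) hU0 hV0 (N + 1) i x
    have h2 := leftEnergy_le_hamiltonian (pinnedChain ω₂ lam β γ) hU0 hV0 (N + 1) i x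
    have hH := hH0 x
    rw [abs_of_nonneg h1]
    calc leftEnergy (pinnedChain ω₂ lam β γ) (N + 1) i x
        ≤ 1 * (1 + (pinnedChain ω₂ lam β γ).hamiltonian (N + 1) x) ^ 2 := by nlinarith
      _ ≤ C * (1 + (pinnedChain ω₂ lam β γ).hamiltonian (N + 1) x) ^ 2 :=
          mul_le_mul_of_nonneg_right hC1 (by positivity)
  have hLb : ∀ x, |(pinnedChain ω₂ lam β γ).generator (N + 1) T_L T_R
      (leftEnergy (pinnedChain ω₂ lam β γ) (N + 1) i) x| ≤
      C * (1 + (pinnedChain ω₂ lam β γ).hamiltonian (N + 1) x) ^ 2 := by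
    intro x
    rw [hLf x]
    have hH := hH0 x
    have hA : |γ * (T_L - x.2 0 ^ 2)| ≤
        γ * (T_L + 2) * (1 + (pinnedChain ω₂ lam β γ).hamiltonian (N + 1) x) ^ 2 := by
      rw [abs_mul, abs_of_nonneg hγ, mul_assoc]
      refine mul_le_mul_of_nonneg_left ?_ hγ
      have := hp2 x 0
      calc |T_L - x.2 0 ^ 2| ≤ |T_L| + |x.2 0 ^ 2| := abs_sub _ _
        _ = T_L + x.2 0 ^ 2 := by rw [abs_of_nonneg hTL, abs_of_nonneg (sq_nonneg _)]
        _ ≤ T_L + 2 * (pinnedChain ω₂ lam β γ).hamiltonian (N + 1) x := by linarith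
        _ ≤ (T_L + 2) * (1 + (pinnedChain ω₂ lam β γ).hamiltonian (N + 1) x) ^ 2 := by
            nlinarith [mul_nonneg hTL hH, sq_nonneg ((pinnedChain ω₂ lam β γ).hamiltonian (N + 1) x),
              mul_nonneg hTL (sq_nonneg ((pinnedChain ω₂ lam β γ).hamiltonian (N + 1) x))]
    have hB : |(pinnedChain ω₂ lam β γ).bondCurrent (N + 1) i x| ≤
        ((N + 1 : ℕ) : ℝ) * ((3 + β) / 2) * (1 + (pinnedChain ω₂ lam β γ).hamiltonian (N + 1) x) ^ 2 := by
      have := pinnedChain_abs_bondCurrent_le hω.le hl hβ γ (N + 1) i x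
      calc _ ≤ _ := this
        _ = _ := by ring
    calc |γ * (T_L - x.2 0 ^ 2) - (pinnedChain ω₂ lam β γ).bondCurrent (N + 1) i x|
        ≤ |γ * (T_L - x.2 0 ^ 2)| + |(pinnedChain ω₂ lam β γ).bondCurrent (N + 1) i x| := abs_sub _ _
      _ ≤ γ * (T_L + 2) * (1 + (pinnedChain ω₂ lam β γ).hamiltonian (N + 1) x) ^ 2 +
          ((N + 1 : ℕ) : ℝ) * ((3 + β) / 2) * (1 + (pinnedChain ω₂ lam β γ).hamiltonian (N + 1) x) ^ 2 :=
          add_le_add hA hB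
      _ ≤ C * (1 + (pinnedChain ω₂ lam β γ).hamiltonian (N + 1) x) ^ 2 := by
          rw [hC]; nlinarith [sq_nonneg (1 + (pinnedChain ω₂ lam β γ).hamiltonian (N + 1) x)]
  have hPb : ∀ (l : Fin (N + 1)) (x : PhaseSpace (N + 1)),
      |partialP l (leftEnergy (pinnedChain ω₂ lam β γ) (N + 1) i) x| ≤
      C * (1 + (pinnedChain ω₂ lam β γ).hamiltonian (N + 1) x) ^ 2 := by
    intro l x
    rw [partialP_leftEnergy (pinnedChain ω₂ lam β γ) i l]
    have hH := hH0 x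
    have hw := blockWeight_nonneg_le_one i l
    have hpl := hp1 x l
    rw [abs_mul, abs_of_nonneg hw.1]
    calc blockWeight i l * |x.2 l| ≤ 1 * (1 + (pinnedChain ω₂ lam β γ).hamiltonian (N + 1) x) :=
          mul_le_mul hw.2 hpl (abs_nonneg _) zero_le_one
      _ ≤ C * (1 + (pinnedChain ω₂ lam β γ).hamiltonian (N + 1) x) ^ 2 := by nlinarith
  -- weak stationarity tested on `E_{≤i}`
  have hsmooth : ContDiff ℝ ((⊤ : ℕ∞) : WithTop ℕ∞) (leftEnergy (pinnedChain ω₂ lam β γ) (N + 1) i) :=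
    contDiff_leftEnergy (pinnedChain ω₂ lam β γ) (pinnedChain_contDiff_U ω₂ lam β γ)
      (pinnedChain_contDiff_V ω₂ lam β γ) (N + 1) i
  have hzero := pinnedChain_integral_generator_eq_zero_of_growth ω₂ lam β γ hω hl hβ hγ (N + 1) hN
    T_L T_R hTL hTR ν hν.2.1 hmom (leftEnergy (pinnedChain ω₂ lam β γ) (N + 1) i) C 2 hsmooth hfb hLb hPb
  -- split the integral
  have hint_sq : Integrable (fun x : PhaseSpace (N + 1) => x.2 0 ^ 2) ν :=
    integrable_sq_momentum hω hl hβ hγ hmom 0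
  have hint1 : Integrable (fun x : PhaseSpace (N + 1) => γ * (T_L - x.2 0 ^ 2)) ν :=
    ((integrable_const T_L).sub hint_sq).const_mul γ
  simp_rw [hLf] at hzero
  rw [integral_sub hint1 (hν.2.2 i), integral_const_mul, integral_sub (integrable_const _) hint_sq,
    integral_const, probReal_univ, one_smul] at hzero
  linarith

/-- **Total energy balance.** Same setting: weak stationarity tested on `H` itself
(`L H = γ(T_L - p_0²) + γ(T_R - p_N²)`, only the baths act on the energy) gives
`γ (T_L - ν(p_0²)) + γ (T_R - ν(p_N²)) = 0` — the energy injected at the left end leaves at the right end.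
[Bonetto–Lebowitz–Rey-Bellet 2000, §5.2 eq. (25)] [folklore] -/
theorem bath_balance {ω₂ lam β γ : ℝ} (hω : 0 < ω₂) (hl : 0 ≤ lam) (hβ : 0 ≤ β)
    (hγ : 0 ≤ γ) {T_L T_R : ℝ} (hTL : 0 ≤ T_L) (hTR : 0 ≤ T_R) {ν : Measure (PhaseSpace (N + 1))}
    (hν : (pinnedChain ω₂ lam β γ).IsSteadyState (N + 1) T_L T_R ν)
    (hmom : ∀ m : ℕ, Integrable (fun x => (1 + (pinnedChain ω₂ lam β γ).hamiltonian (N + 1) x) ^ m) ν) :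
    γ * (T_L - ∫ x, x.2 0 ^ 2 ∂ν) + γ * (T_R - ∫ x, x.2 (Fin.last N) ^ 2 ∂ν) = 0 := by
  haveI := hν.1
  have hconf : (pinnedChain ω₂ lam β γ).IsConfining := pinnedChain_isConfining hω hl hβ hγ
  have hU0 := hconf.U_nonneg
  have hV0 := hconf.V_nonneg
  have hH0 : ∀ x, 0 ≤ (pinnedChain ω₂ lam β γ).hamiltonian (N + 1) x := hconf.hamiltonian_nonneg (N + 1)
  have hPγ : (pinnedChain ω₂ lam β γ).γ = γ := rfl
  have hN : 0 < N + 1 := Nat.succ_pos N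
  have hNl : N < N + 1 := Nat.lt_succ_self N
  have h0 : (⟨0, hN⟩ : Fin (N + 1)) = 0 := rfl
  have hlast : (⟨N, hNl⟩ : Fin (N + 1)) = Fin.last N := rfl
  -- pointwise form of `L H`
  have hLH : ∀ x, (pinnedChain ω₂ lam β γ).generator (N + 1) T_L T_R
      ((pinnedChain ω₂ lam β γ).hamiltonian (N + 1)) x =
      γ * (T_L - x.2 0 ^ 2) + γ * (T_R - x.2 (Fin.last N) ^ 2) := by
    intro x
    rw [generator_hamiltonian_eq (pinnedChain ω₂ lam β γ) (N + 1) T_L T_R x, Finset.sum_add_distrib,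
      sum_ite_val_eq hN (fun k => T_L - x.2 k ^ 2)]
    simp only [Nat.add_sub_cancel]
    rw [sum_ite_val_eq hNl (fun k => T_R - x.2 k ^ 2), hPγ, h0, hlast, mul_add]
  -- the growth bounds
  have hp1 : ∀ (x : PhaseSpace (N + 1)) (k : Fin (N + 1)),
      |x.2 k| ≤ 1 + (pinnedChain ω₂ lam β γ).hamiltonian (N + 1) x :=
    fun x k => abs_momentum_le_one_add hU0 hV0 x k
  have hp2 : ∀ (x : PhaseSpace (N + 1)) (k : Fin (N + 1)),
      x.2 k ^ 2 ≤ 2 * (pinnedChain ω₂ lam β γ).hamiltonian (N + 1) x :=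
    fun x k => sq_momentum_le hU0 hV0 x k
  set C : ℝ := 1 + γ * (T_L + T_R + 4) with hC
  have hC1 : 1 ≤ C := by
    have : 0 ≤ γ * (T_L + T_R + 4) := by positivity
    rw [hC]; linarith
  have hfb : ∀ x, |(pinnedChain ω₂ lam β γ).hamiltonian (N + 1) x| ≤
      C * (1 + (pinnedChain ω₂ lam β γ).hamiltonian (N + 1) x) ^ 2 := by
    intro x
    have hH := hH0 x
    rw [abs_of_nonneg hH]
    calc (pinnedChain ω₂ lam β γ).hamiltonian (N + 1) x
        ≤ 1 * (1 + (pinnedChain ω₂ lam β γ).hamiltonian (N + 1) x) ^ 2 := by nlinarith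
      _ ≤ C * (1 + (pinnedChain ω₂ lam β γ).hamiltonian (N + 1) x) ^ 2 :=
          mul_le_mul_of_nonneg_right hC1 (by positivity)
  have hbath : ∀ (T : ℝ), 0 ≤ T → ∀ (x : PhaseSpace (N + 1)) (k : Fin (N + 1)),
      |γ * (T - x.2 k ^ 2)| ≤ γ * (T + 2) * (1 + (pinnedChain ω₂ lam β γ).hamiltonian (N + 1) x) ^ 2 := by
    intro T hT x k
    have hH := hH0 x
    rw [abs_mul, abs_of_nonneg hγ, mul_assoc]
    refine mul_le_mul_of_nonneg_left ?_ hγ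
    have := hp2 x k
    calc |T - x.2 k ^ 2| ≤ |T| + |x.2 k ^ 2| := abs_sub _ _
      _ = T + x.2 k ^ 2 := by rw [abs_of_nonneg hT, abs_of_nonneg (sq_nonneg _)]
      _ ≤ T + 2 * (pinnedChain ω₂ lam β γ).hamiltonian (N + 1) x := by linarith
      _ ≤ (T + 2) * (1 + (pinnedChain ω₂ lam β γ).hamiltonian (N + 1) x) ^ 2 := by
          nlinarith [mul_nonneg hT hH, sq_nonneg ((pinnedChain ω₂ lam β γ).hamiltonian (N + 1) x),
            mul_nonneg hT (sq_nonneg ((pinnedChain ω₂ lam β γ).hamiltonian (N + 1) x))]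
  have hLb : ∀ x, |(pinnedChain ω₂ lam β γ).generator (N + 1) T_L T_R
      ((pinnedChain ω₂ lam β γ).hamiltonian (N + 1)) x| ≤
      C * (1 + (pinnedChain ω₂ lam β γ).hamiltonian (N + 1) x) ^ 2 := by
    intro x
    rw [hLH x]
    have hH := hH0 x
    have hA := hbath T_L hTL x 0
    have hB := hbath T_R hTR x (Fin.last N)
    calc |γ * (T_L - x.2 0 ^ 2) + γ * (T_R - x.2 (Fin.last N) ^ 2)|
        ≤ |γ * (T_L - x.2 0 ^ 2)| + |γ * (T_R - x.2 (Fin.last N) ^ 2)| := abs_add_le _ _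
      _ ≤ γ * (T_L + 2) * (1 + (pinnedChain ω₂ lam β γ).hamiltonian (N + 1) x) ^ 2 +
          γ * (T_R + 2) * (1 + (pinnedChain ω₂ lam β γ).hamiltonian (N + 1) x) ^ 2 := add_le_add hA hB
      _ ≤ C * (1 + (pinnedChain ω₂ lam β γ).hamiltonian (N + 1) x) ^ 2 := by
          rw [hC]; nlinarith [sq_nonneg (1 + (pinnedChain ω₂ lam β γ).hamiltonian (N + 1) x)]
  have hPb : ∀ (l : Fin (N + 1)) (x : PhaseSpace (N + 1)),
      |partialP l ((pinnedChain ω₂ lam β γ).hamiltonian (N + 1)) x| ≤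
      C * (1 + (pinnedChain ω₂ lam β γ).hamiltonian (N + 1) x) ^ 2 := by
    intro l x
    rw [(pinnedChain ω₂ lam β γ).partialP_hamiltonian (N + 1) x l]
    have hH := hH0 x
    have hpl := hp1 x l
    calc |x.2 l| ≤ 1 * (1 + (pinnedChain ω₂ lam β γ).hamiltonian (N + 1) x) := by linarith
      _ ≤ C * (1 + (pinnedChain ω₂ lam β γ).hamiltonian (N + 1) x) ^ 2 := by nlinarith
  -- weak stationarity tested on `H`
  have hsmooth : ContDiff ℝ ((⊤ : ℕ∞) : WithTop ℕ∞) ((pinnedChain ω₂ lam β γ).hamiltonian (N + 1)) :=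
    (pinnedChain ω₂ lam β γ).contDiff_hamiltonian (pinnedChain_contDiff_U ω₂ lam β γ)
      (pinnedChain_contDiff_V ω₂ lam β γ) (N + 1)
  have hzero := pinnedChain_integral_generator_eq_zero_of_growth ω₂ lam β γ hω hl hβ hγ (N + 1) hN
    T_L T_R hTL hTR ν hν.2.1 hmom ((pinnedChain ω₂ lam β γ).hamiltonian (N + 1)) C 2 hsmooth hfb hLb hPb
  -- split the integral
  have hint0 : Integrable (fun x : PhaseSpace (N + 1) => x.2 0 ^ 2) ν :=
    integrable_sq_momentum hω hl hβ hγ hmom 0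
  have hintN : Integrable (fun x : PhaseSpace (N + 1) => x.2 (Fin.last N) ^ 2) ν :=
    integrable_sq_momentum hω hl hβ hγ hmom (Fin.last N)
  have hint1 : Integrable (fun x : PhaseSpace (N + 1) => γ * (T_L - x.2 0 ^ 2)) ν :=
    ((integrable_const T_L).sub hint0).const_mul γ
  have hint2 : Integrable (fun x : PhaseSpace (N + 1) => γ * (T_R - x.2 (Fin.last N) ^ 2)) ν :=
    ((integrable_const T_R).sub hintN).const_mul γ
  simp_rw [hLH] at hzero
  rw [integral_add hint1 hint2, integral_const_mul, integral_const_mul,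
    integral_sub (integrable_const _) hint0, integral_sub (integrable_const _) hintN,
    integral_const, integral_const, probReal_univ, one_smul, one_smul] at hzero
  exact hzero

/-! ### The stub -/

/-- **Energy balance in a weak steady state with one exponential moment** (stub `stub_energyBalance` of line
`gibbs-ttcf`): for the pinned anharmonic chain `pinnedChain ω₂ lam β γ` (all parameters `> 0`) with `N + 1`
sites, bath temperatures `T_L, T_R > 0`, and any weak steady state `ν` (`OscillatorChain.IsSteadyState`)
integrating `e^{θH}` for some `θ > 0`, the space-summed steady current is `N` times the power absorbed by the
right bath: `totalCurrent ν = N · γ · (∫ p_N² dν - T_R)`. Proof: polynomial moments from the exponential one;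
weak stationarity extended to polynomially bounded smooth observables (energy cut-off + dominated convergence)
and tested on the left block energies `E_{≤i}` (`ν(j_i) = γ(T_L - ν(p_0²))` for every genuine bond) and on `H`
(`γ(T_L - ν(p_0²)) = γ(ν(p_N²) - T_R)`); the last index of `Fin (N + 1)` carries no bond.
[Bonetto–Lebowitz–Rey-Bellet 2000, §5.2 eqs. (25)–(27)] [folklore] -/
theorem stub_energyBalance :
    ∀ ω₂ lam β γ : ℝ, 0 < ω₂ → 0 < lam → 0 < β → 0 < γ → ∀ (N : ℕ) (T_L T_R : ℝ), 0 < T_L → 0 < T_R →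
    ∀ ν : Measure (PhaseSpace (N + 1)),
      (pinnedChain ω₂ lam β γ).IsSteadyState (N + 1) T_L T_R ν →
      (∃ θ : ℝ, 0 < θ ∧
        Integrable (fun z => Real.exp (θ * (pinnedChain ω₂ lam β γ).hamiltonian (N + 1) z)) ν) →
      (pinnedChain ω₂ lam β γ).totalCurrent ν =
        (N : ℝ) * γ * ((∫ z, (z.2 (Fin.last N)) ^ 2 ∂ν) - T_R) := by
  intro ω₂ lam β γ hω hl hβ hγ N T_L T_R hTL hTR ν hν hexp
  obtain ⟨θ, hθ, hint⟩ := hexp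
  have hmom := pinnedChain_polynomialMoments ω₂ lam β γ hω.le hl.le hβ.le (N + 1) ν θ hθ hint
  have hbal := bath_balance hω hl.le hβ.le hγ.le hTL.le hTR.le hν hmom
  have hbond : ∀ i : Fin (N + 1), ∫ x, (pinnedChain ω₂ lam β γ).bondCurrent (N + 1) i x ∂ν =
      if i.val + 1 < N + 1 then γ * (T_L - ∫ x, x.2 0 ^ 2 ∂ν) else 0 := by
    intro i
    split_ifs with hi
    · exact integral_bondCurrent_eq_left hω hl.le hβ.le hγ.le hTL.le hTR.le hν hmom hi
    · simp [bondCurrent_eq_zero_of_not_lt _ hi]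
  unfold OscillatorChain.totalCurrent
  simp_rw [hbond]
  rw [Fin.sum_univ_castSucc]
  have hcast : ∀ i : Fin N, (if (Fin.castSucc i).val + 1 < N + 1 then γ * (T_L - ∫ x, x.2 0 ^ 2 ∂ν) else 0) =
      γ * (T_L - ∫ x, x.2 0 ^ 2 ∂ν) := fun i => by
    rw [if_pos]
    simp only [Fin.val_castSucc]
    have := i.isLt
    omega
  have hlast : (if (Fin.last N).val + 1 < N + 1 then γ * (T_L - ∫ x, x.2 0 ^ 2 ∂ν) else 0) = 0 := by
    rw [if_neg]
    simp
  rw [Finset.sum_congr rfl fun i _ => hcast i, hlast, Finset.sum_const, Finset.card_univ, Fintype.card_fin,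
    nsmul_eq_mul, add_zero]
  linear_combination (N : ℝ) * hbal

end Summit.AtomisticToContinuum.FouriersLaw.Theorems.BoundaryKubo.GibbsTtcf

end
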